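import Summits.AtomisticToContinuum.BoseEinsteinCondensation.Theorems.BECThomsonPrincipleGDTransferDefs
import Summits.AtomisticToContinuum.BoseEinsteinCondensation.Theorems.BECThomsonPrincipleGDTransferChordVariationSrcPair

/-!
# Route `BECThomsonPrinciple`, crux `GDTransfer` (stmt-AtomisticToContinuum-9482), line `dyson-dressed-witness`:
# stub `lnssAlgebra`, part 1 — the commuting projections `P_i`, `Q_S` on `L²(cell^N) ∩ C⁰`

Support file of `stub_lnssAlgebra` (`LNSSAlgebra`: the configuration-space Lewin–Nam–Serfaty–Solovej
identities).  On continuous functions the crux's cell averages `P_i` (`Negative.cellAvg`) are commuting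
self-adjoint idempotents (`Negative.Structure{,II}`), whence for the `foldr` projections
`Q_S = Π_{i∈S} P_i Π_{i∉S}(1 - P_i)` (`Negative.modeProj`): `P_i Q_S = [i ∈ S] Q_S` (`cellAvg_modeProj`),
`P_i` commutes with `Q_S` (`cellAvg_foldr_comm`) so that `Q_S` kills functions flat in a slot `i ∉ S`
(`modeProj_eq_zero_of_cellAvg_eq`), `Σ_S Q_S = 1` (`sum_modeProj`), the `foldr` does not depend on the
order of its factors (`foldr_perm`) and is relabelling-covariant (`modeProj_comp_perm`), `Q_S` is
self-adjoint (`integral_conj_mul_modeProj`), the `Q_S g` are pairwise orthogonal with Pythagoras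
(`integral_norm_sq_sum_modeProj`); plus linearity over finite sums and the relabelling invariance of the
Bochner integral on `cell^N` (`setIntegral_cellN_comp_perm`).  Several lemmas are adapted from the
(private) toolkit of `BECThomsonPrincipleGaussianDominationCanThetaNorm.lean`.  All [folklore]
(LSSY2005 App. A; arXiv:1211.2778 §2).
-/

noncomputable section

open MeasureTheory Filter
open scoped ENNReal NNReal ComplexConjugate

namespace Summit.AtomisticToContinuum.BoseEinsteinCondensation.Cruxes.GDTransfer.DysonDressedWitness

namespace Lnss

open Literature.MathematicalPhysics.QuantumManyBody.BoseGas
open Summit.AtomisticToContinuum.BoseEinsteinCondensation.Theorems.GaussianDominationCan.Negative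
open ChordVariation (continuous_foldr_cellAvg continuous_modeProj modeProj_add)

variable {N m : ℕ} {L : ℝ}

/-! ## Relabelling invariance of the Bochner integral on the cell -/

/-- **Lebesgue measure on `cell^N` is relabelling invariant** (Bochner form, any Banach range):
`∫_{cell^N} F(X ∘ σ) dX = ∫_{cell^N} F`. [folklore] -/
theorem setIntegral_cellN_comp_perm {E : Type*} [NormedAddCommGroup E] [NormedSpace ℝ E]
    (σ : Equiv.Perm (Fin N)) (F : Config N → E) :
    ∫ X in cellN N L, F (X ∘ σ) = ∫ X in cellN N L, F X := by
  -- adapted from `lintegral_cellN_comp_perm` of `PeriodicBoseGasThm31`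
  set e := (MeasurableEquiv.piCongrLeft (fun _ : Fin N => Space) σ).symm with he
  have hmp : MeasurePreserving e volume volume :=
    (volume_measurePreserving_piCongrLeft (fun _ : Fin N => Space) σ).symm
  have heX : ∀ (X : Config N) (j : Fin N), e X j = X (σ j) := fun X j => rfl
  have hpre : e ⁻¹' cellN N L = cellN N L := by
    ext X
    simp only [Set.mem_preimage, cellN, Set.mem_setOf_eq, heX]
    exact ⟨fun h i => by simpa using h (σ.symm i), fun h i => h _⟩
  have key := hmp.setIntegral_preimage_emb e.measurableEmbedding F (cellN N L)
  rw [hpre] at key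
  exact key

/-! ## Linearity of `P_i`, `Q_S` over finite sums; flat functions -/

/-- `P_i 0 = 0`. [folklore] -/
theorem cellAvg_zero (i : Fin N) : cellAvg N L i (0 : Config N → ℂ) = 0 := by
  funext X; simp [cellAvg]

/-- `P_i` through a finite linear combination of continuous functions. [folklore] -/
theorem cellAvg_finset_sum {ι : Type*} (T : Finset ι) (c : ι → ℂ) {f : ι → Config N → ℂ}
    (hf : ∀ t ∈ T, Continuous (f t)) (i : Fin N) :
    cellAvg N L i (fun X => ∑ t ∈ T, c t * f t X) =
      fun X => ∑ t ∈ T, c t * cellAvg N L i (f t) X := by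
  funext X
  unfold cellAvg
  have hint : ∀ t ∈ T, Integrable (fun y => c t * f t (Function.update X i y))
      ((volume : Measure Space).restrict (cell L)) := fun t ht =>
    (integrableOn_cell ((hf t ht).comp ((continuous_const (y := X)).update i continuous_id))).const_mul
      (c t)
  rw [integral_finsetSum T hint, Finset.smul_sum]
  refine Finset.sum_congr rfl fun t _ => ?_
  rw [integral_const_mul, mul_smul_comm]

/-- The `foldr` kills `0`. [folklore] -/
theorem foldr_cellAvg_zero (S : Finset (Fin N)) (l : List (Fin N)) :
    l.foldr (fun i h => if i ∈ S then cellAvg N L i h else h - cellAvg N L i h)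
      (0 : Config N → ℂ) = 0 := by
  induction l with
  | nil => rfl
  | cons a l ih =>
    rw [List.foldr_cons, ih]
    split_ifs
    · exact cellAvg_zero a
    · rw [cellAvg_zero, sub_zero]

/-- **`Q_S` through a finite sum** of continuous functions. [folklore] -/
theorem modeProj_finset_sum {ι : Type*} (T : Finset ι) {f : ι → Config N → ℂ}
    (hf : ∀ t ∈ T, Continuous (f t)) (S : Finset (Fin N)) :
    modeProj N L S (fun X => ∑ t ∈ T, f t X) = fun X => ∑ t ∈ T, modeProj N L S (f t) X := by
  classical
  induction T using Finset.induction_on with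
  | empty =>
    simp only [Finset.sum_empty]
    exact foldr_cellAvg_zero S _
  | insert a T haT ih =>
    have hfa : Continuous (f a) := hf a (Finset.mem_insert_self a T)
    have hfT : ∀ t ∈ T, Continuous (f t) := fun t ht => hf t (Finset.mem_insert_of_mem ht)
    have hsum : Continuous (fun X => ∑ t ∈ T, f t X) := continuous_finsetSum T fun t ht => hfT t ht
    simp only [Finset.sum_insert haT]
    have h : (fun X => f a X + ∑ t ∈ T, f t X) = f a + fun X => ∑ t ∈ T, f t X := rfl
    rw [h, modeProj_add S hfa hsum, ih hfT]
    rfl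

/-- A function that does not depend on slot `i` is FLAT there: `P_i g = g` (`L > 0`). [folklore] -/
theorem cellAvg_eq_self_of_update (hL : 0 < L) {i : Fin N} {g : Config N → ℂ}
    (hg : ∀ X z, g (Function.update X i z) = g X) : cellAvg N L i g = g := by
  funext X
  unfold cellAvg
  simp_rw [hg X]
  rw [integral_cell_const hL, Complex.real_smul, ← mul_assoc]
  have hL' : (L : ℂ) ≠ 0 := by exact_mod_cast hL.ne'
  rw [show (((L ^ 3)⁻¹ : ℝ) : ℂ) * (L : ℂ) ^ 3 = 1 by
    rw [Complex.ofReal_inv, Complex.ofReal_pow, inv_mul_cancel₀ (pow_ne_zero 3 hL')], one_mul]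

/-! ## `P_i` on and through `Q_S` -/

/-- `P_i` on the `foldr` over a duplicate-free list containing `i`: the identity if `i ∈ S`, zero
otherwise. [folklore] -/
theorem cellAvg_foldr (hL : 0 < L) (S : Finset (Fin N)) (l : List (Fin N)) (hl : l.Nodup)
    {g : Config N → ℂ} (hg : Continuous g) (i : Fin N) (hi : i ∈ l) :
    cellAvg N L i (l.foldr (fun i h => if i ∈ S then cellAvg N L i h else h - cellAvg N L i h) g) =
      if i ∈ S then l.foldr (fun i h => if i ∈ S then cellAvg N L i h else h - cellAvg N L i h) g
      else 0 := by
  -- adapted from `cellAvg_foldr` of `BECThomsonPrincipleGaussianDominationCanThetaNorm`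
  induction l with
  | nil => simp at hi
  | cons a l ih =>
    rw [List.nodup_cons] at hl
    have hc := continuous_foldr_cellAvg (L := L) S l hg
    rw [List.foldr_cons]
    rcases List.mem_cons.1 hi with hia | hil
    · rw [hia]
      by_cases haS : a ∈ S
      · rw [if_pos haS, if_pos haS]
        exact cellAvg_cellAvg hL a _
      · rw [if_neg haS, if_neg haS]
        exact cellAvg_sub_cellAvg hL a _ fun X =>
          integrableOn_cell (hc.comp ((continuous_const (y := X)).update a continuous_id))
    · have key := ih hl.2 hil
      by_cases haS : a ∈ S
      · rw [if_pos haS, cellAvg_comm i a hc, key]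
        by_cases hiS : i ∈ S
        · rw [if_pos hiS, if_pos hiS]
        · rw [if_neg hiS, if_neg hiS, cellAvg_zero]
      · rw [if_neg haS, cellAvg_sub i hc (continuous_cellAvg a hc), cellAvg_comm i a hc, key]
        by_cases hiS : i ∈ S
        · rw [if_pos hiS, if_pos hiS]
        · rw [if_neg hiS, if_neg hiS, cellAvg_zero, sub_zero]

/-- **`P_i Q_S g = [i ∈ S] Q_S g`** on continuous `g`. [folklore] -/
theorem cellAvg_modeProj (hL : 0 < L) (S : Finset (Fin N)) (i : Fin N) {g : Config N → ℂ}
    (hg : Continuous g) :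
    cellAvg N L i (modeProj N L S g) = if i ∈ S then modeProj N L S g else 0 :=
  cellAvg_foldr hL S (List.finRange N) (List.nodup_finRange N) hg i (List.mem_finRange i)

/-- `P_a` commutes with the `foldr` on continuous functions. [folklore] -/
theorem cellAvg_foldr_comm (S : Finset (Fin N)) (l : List (Fin N)) (a : Fin N) {g : Config N → ℂ}
    (hg : Continuous g) :
    cellAvg N L a (l.foldr (fun i h => if i ∈ S then cellAvg N L i h else h - cellAvg N L i h) g) =
      l.foldr (fun i h => if i ∈ S then cellAvg N L i h else h - cellAvg N L i h)
        (cellAvg N L a g) := by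
  induction l with
  | nil => rfl
  | cons b l ih =>
    have hc := continuous_foldr_cellAvg (L := L) S l hg
    rw [List.foldr_cons, List.foldr_cons, ← ih]
    by_cases hbS : b ∈ S
    · rw [if_pos hbS, if_pos hbS]
      exact cellAvg_comm a b hc
    · rw [if_neg hbS, if_neg hbS, cellAvg_sub a hc (continuous_cellAvg b hc), cellAvg_comm a b hc]

/-- **`Q_S` kills continuous functions flat in a slot `i ∉ S`** (`P_i g = g`). [folklore] -/
theorem modeProj_eq_zero_of_cellAvg_eq (hL : 0 < L) {S : Finset (Fin N)} {i : Fin N} (hi : i ∉ S)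
    {g : Config N → ℂ} (hg : Continuous g) (hflat : cellAvg N L i g = g) :
    modeProj N L S g = 0 := by
  calc modeProj N L S g = cellAvg N L i (modeProj N L S g) := by
        unfold modeProj
        rw [cellAvg_foldr_comm S _ i hg, hflat]
    _ = 0 := by rw [cellAvg_modeProj hL S i hg, if_neg hi]

/-! ## Resolution of the identity `Σ_S Q_S = 1` -/

/-- The `foldr` sees `S` only through the membership of the listed indices. [folklore] -/
theorem foldr_congr_set {S T : Finset (Fin N)} (l : List (Fin N))
    (hST : ∀ i ∈ l, (i ∈ S ↔ i ∈ T)) (g : Config N → ℂ) :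
    l.foldr (fun i h => if i ∈ S then cellAvg N L i h else h - cellAvg N L i h) g =
      l.foldr (fun i h => if i ∈ T then cellAvg N L i h else h - cellAvg N L i h) g := by
  -- adapted from `BECThomsonPrincipleGaussianDominationCanThetaNorm`
  induction l with
  | nil => rfl
  | cons a l ih =>
    have ha := hST a List.mem_cons_self
    rw [List.foldr_cons, List.foldr_cons, ih fun i hi => hST i (List.mem_cons_of_mem a hi)]
    by_cases haS : a ∈ S
    · rw [if_pos haS, if_pos (ha.1 haS)]
    · rw [if_neg haS, if_neg fun h => haS (ha.2 h)]

/-- `Σ_{U ⊆ l} (foldr over l for U) g = g`: each factor splits as `P_a + (1 - P_a) = 1`. [folklore] -/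
theorem sum_powerset_foldr (l : List (Fin N)) (hl : l.Nodup) (g : Config N → ℂ) :
    ∑ U ∈ l.toFinset.powerset,
      l.foldr (fun i h => if i ∈ U then cellAvg N L i h else h - cellAvg N L i h) g = g := by
  -- adapted from `BECThomsonPrincipleGaussianDominationCanThetaNorm`
  induction l with
  | nil => simp
  | cons a l ih =>
    rw [List.nodup_cons] at hl
    have hal : a ∉ l.toFinset := fun h => hl.1 (List.mem_toFinset.1 h)
    rw [List.toFinset_cons, Finset.sum_powerset_insert hal, ← Finset.sum_add_distrib]
    refine Eq.trans (Finset.sum_congr rfl fun U hU => ?_) (ih hl.2)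
    have haU : a ∉ U := fun h => hal (Finset.mem_powerset.1 hU h)
    have h3 :
        l.foldr (fun i h => if i ∈ insert a U then cellAvg N L i h else h - cellAvg N L i h) g =
          l.foldr (fun i h => if i ∈ U then cellAvg N L i h else h - cellAvg N L i h) g :=
      foldr_congr_set l (fun i hi => by
        have hia : i ≠ a := fun e => hl.1 (e ▸ hi)
        simp only [Finset.mem_insert, hia, false_or]) g
    rw [List.foldr_cons, List.foldr_cons, if_neg haU, if_pos (Finset.mem_insert_self a U), h3]
    exact sub_add_cancel _ _

/-- **Resolution of the identity**: `Σ_S Q_S g = g`. [folklore] -/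
theorem sum_modeProj (g : Config N → ℂ) : ∑ S : Finset (Fin N), modeProj N L S g = g := by
  unfold modeProj
  have h := sum_powerset_foldr (L := L) (List.finRange N) (List.nodup_finRange N) g
  rwa [List.toFinset_finRange, Finset.powerset_univ] at h

/-! ## Order independence and relabelling covariance of the `foldr` -/

/-- Two consecutive steps of the `foldr` commute on continuous functions. [folklore] -/
theorem step_comm (S : Finset (Fin N)) (a b : Fin N) {h : Config N → ℂ}
    (hc : Continuous h) :
    (if a ∈ S then cellAvg N L a (if b ∈ S then cellAvg N L b h else h - cellAvg N L b h)
      else (if b ∈ S then cellAvg N L b h else h - cellAvg N L b h) -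
        cellAvg N L a (if b ∈ S then cellAvg N L b h else h - cellAvg N L b h)) =
    (if b ∈ S then cellAvg N L b (if a ∈ S then cellAvg N L a h else h - cellAvg N L a h)
      else (if a ∈ S then cellAvg N L a h else h - cellAvg N L a h) -
        cellAvg N L b (if a ∈ S then cellAvg N L a h else h - cellAvg N L a h)) := by
  -- adapted from `BECThomsonPrincipleGaussianDominationCanThetaNorm`
  have hca := continuous_cellAvg (L := L) a hc
  have hcb := continuous_cellAvg (L := L) b hc
  have hcomm := cellAvg_comm (L := L) a b hc
  by_cases haS : a ∈ S <;> by_cases hbS : b ∈ S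
  · simp only [if_pos haS, if_pos hbS]
    exact hcomm
  · simp only [if_pos haS, if_neg hbS]
    rw [cellAvg_sub a hc hcb, hcomm]
  · simp only [if_neg haS, if_pos hbS]
    rw [cellAvg_sub b hc hca, hcomm]
  · simp only [if_neg haS, if_neg hbS]
    rw [cellAvg_sub a hc hcb, cellAvg_sub b hc hca, hcomm]
    abel

/-- **The `foldr` does not depend on the order** of its (commuting) factors. [folklore] -/
theorem foldr_perm (S : Finset (Fin N)) {l₁ l₂ : List (Fin N)} (p : l₁.Perm l₂)
    {g : Config N → ℂ} (hg : Continuous g) :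
    l₁.foldr (fun i h => if i ∈ S then cellAvg N L i h else h - cellAvg N L i h) g =
      l₂.foldr (fun i h => if i ∈ S then cellAvg N L i h else h - cellAvg N L i h) g := by
  -- adapted from `BECThomsonPrincipleGaussianDominationCanThetaNorm`
  induction p with
  | nil => rfl
  | cons a _ ih => rw [List.foldr_cons, List.foldr_cons, ih]
  | swap a b l =>
    simp only [List.foldr_cons]
    exact step_comm S b a (continuous_foldr_cellAvg S l hg)
  | trans _ _ ih₁ ih₂ => exact ih₁.trans ih₂

/-- Relabelling intertwines the cell averages: `(P_j h)(X ∘ τ) = (P_{τ j} (h ∘ (· ∘ τ)))(X)`.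
[folklore] -/
theorem cellAvg_comp_perm (τ : Equiv.Perm (Fin N)) (j : Fin N) (h : Config N → ℂ)
    (X : Config N) :
    cellAvg N L j h (X ∘ τ) = cellAvg N L (τ j) (fun Y => h (Y ∘ τ)) X := by
  unfold cellAvg
  simp only [Function.update_comp_equiv, Equiv.symm_apply_apply]

/-- Relabelling carries the `foldr` to the `foldr` with relabelled cell averages. [folklore] -/
theorem foldr_comp_perm (τ : Equiv.Perm (Fin N)) (S : Finset (Fin N)) (l : List (Fin N))
    (g : Config N → ℂ) :
    (fun X => l.foldr (fun i h => if i ∈ S then cellAvg N L i h else h - cellAvg N L i h) g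
        (X ∘ τ)) =
      l.foldr (fun i h => if i ∈ S then cellAvg N L (τ i) h else h - cellAvg N L (τ i) h)
        (fun X => g (X ∘ τ)) := by
  -- adapted from `BECThomsonPrincipleGaussianDominationCanThetaNorm`
  induction l with
  | nil => rfl
  | cons a l ih =>
    simp only [List.foldr_cons]
    rw [← ih]
    funext X
    by_cases haS : a ∈ S
    · simp only [if_pos haS]
      exact cellAvg_comp_perm τ a _ X
    · simp only [if_neg haS, Pi.sub_apply]
      rw [cellAvg_comp_perm τ a _ X]

/-- **`Q_S` is relabelling-covariant**: `(Q_S g)(X ∘ τ) = (Q_{τS} (g ∘ (· ∘ τ)))(X)`. [folklore] -/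
theorem modeProj_comp_perm (τ : Equiv.Perm (Fin N)) (S : Finset (Fin N)) {g : Config N → ℂ}
    (hg : Continuous g) :
    (fun X => modeProj N L S g (X ∘ τ)) =
      modeProj N L (S.map τ.toEmbedding) (fun X => g (X ∘ τ)) := by
  -- adapted from `BECThomsonPrincipleGaussianDominationCanThetaNorm`
  have hgc : Continuous fun X : Config N => g (X ∘ τ) :=
    hg.comp (continuous_pi fun j => continuous_apply (τ j))
  have hmap : ((List.finRange N).map τ).foldr (fun i h => if i ∈ S.map τ.toEmbedding
        then cellAvg N L i h else h - cellAvg N L i h) (fun X => g (X ∘ τ)) =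
      (List.finRange N).foldr (fun i h => if i ∈ S then cellAvg N L (τ i) h
        else h - cellAvg N L (τ i) h) (fun X => g (X ∘ τ)) := by
    rw [List.foldr_map]
    simp only [Finset.mem_map_equiv, Equiv.symm_apply_apply]
  unfold modeProj
  rw [foldr_comp_perm τ S (List.finRange N) g, ← hmap]
  exact foldr_perm (S.map τ.toEmbedding) (Equiv.Perm.map_finRange_perm τ) hgc

end Lnss

/-- **Part 1a of `stub_lnssAlgebra` (registered helper statement)**: the resolution of the identity
`Σ_S Q_S g = g` for the crux's mode projections. [folklore] -/
theorem lnssAlgebra_sum_modeProj :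
    ∀ (N : ℕ) (L : ℝ) (g : Literature.MathematicalPhysics.QuantumManyBody.BoseGas.Config N → ℂ),
      ∑ S : Finset (Fin N),
        Summit.AtomisticToContinuum.BoseEinsteinCondensation.Theorems.GaussianDominationCan.Negative.modeProj
          N L S g = g :=
  fun _ _ g => Lnss.sum_modeProj g

end Summit.AtomisticToContinuum.BoseEinsteinCondensation.Cruxes.GDTransfer.DysonDressedWitness

end
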